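import Literature.MathematicalPhysics.QuantumFieldTheory.Balaban1983to89.B9Eq344ResolventGradientRowTower
import Literature.MathematicalPhysics.QuantumFieldTheory.Balaban1983to89.B9Eq344HessianRowDecomposition
import Literature.MathematicalPhysics.QuantumFieldTheory.Balaban1983to89.B9Eq3117CommutatorBound
import Literature.MathematicalPhysics.QuantumFieldTheory.Balaban1983to89.B9SectCLatticeFrame

/-!
# `Balaban1983to89.B9Eq344CovariantHessianRowTower` — T. Bałaban, *Propagators for lattice gauge theories in a background field*, Commun. Math. Phys. **99** (1985)
# 389–434 [Balaban1985BackgroundPropagators] Thm 3.1 (3.44) p. 398, (3.117)–(3.120) p. 419, Thm 3.13 p. 426 (*«Let us assume that the gauge field U satisfies (3.35),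
# (3.36) …»*): **THE `cosh`-WEIGHTED η-SCALE COVARIANT HESSIAN ROW OF A SOLUTION OF `Δ^η_Uu = ω` ON THE MODEL, ON THE SMALL-FIELD CLASS WITH THE CURRENT WINDOW
# `‖J‖ ≤ α` — CLOSED.**  For `u, ω` with `Δ^η_Uu = ω`, `cosh`-weighted (centre `x₀`) bounds `‖ω‖ ≤ N_ω·W`, `‖ω(y′) − ω(y)‖ ≤ H_ω·W(y)·(d(y,y′)∕L^{n+1})^{½}` (`d ≤ L^{n+1}`),
# `‖u‖ ≤ M_u·W`, `‖D_Uu‖ ≤ M_w·W`:  `‖(D_U(D_Uu)(·,μ))(b)‖ ≤ Θ_H·(N_ω + H_ω + M_u + M_w)·W_{x₀}(b₋)`.  This is the analytic core of this lineage's route to STOREY H's `H3`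
# (the covariant Hessian row of `u = G′_kω`, `ω = R_kG′_kD*_Uf`, `Δ^η_Uu = ω` by `B9Eq325GreenPrimeOnProjRange`): the docking (block-decay ↔ `cosh` conversions, the rows of
# `ω`, `u`, `D_Uu` from (HLa) ∕ gen 93's letters) is the successor's.  NE9 crux-team LEAF PROVER 01, gen 95.
#
# MECHANISM.  `B9Eq344HessianRowDecomposition.covDeriv_hessSlice_eq`: `D_Uw_μ = D_U(Δ^η_U+1)⁻¹D*_U(A_ω) + D_U(Δ^η_U+1)⁻¹(Comm_μ(u) + w_μ)`, `w_μ = (D_Uu)(·,μ)`,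
# `A_ω(y,κ) = −δ_{κμ}R_{y,μ}ω(y+e_μ)`; the first word by (L2) `B9Eq344ResolventGradientRowTower.exists_gradRow_resolvent_covDiv_holder` (the data `A_ω` has
# `‖A_ω‖ ≤ e^aN_ω·W` and Hölder constant `e^a(H_ω + 2cαN_ω)`, `c = 2M_φM_φ′`, using `‖R − 1‖ ≤ cαη`, `η ≤ (d∕L^{n+1})^{½}` for `d ≥ 1` and `d(y+e_μ, y′+e_μ) = d(y,y′)`);
# the second by gen 93's (L1) `B9Eq342ResolventGradLetterTower.exists_gradLetter_resolvent` on the sup data `Comm_μ(u) + w_μ`, bounded by `B9Eq3117CommutatorBound.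
# norm_commutator_sum_le` (`‖Comm_μ(u)(y)‖ ≤ M_φM_φ′[(2‖J_μ(y)‖ + 8dα²η)‖u(y+e_μ)‖ + 2αΣ_κ(…‖D_Uu‖…)]`) and the current window `‖J‖ ≤ α` — THIS is where (3.36) enters.

statement-level skeleton of published theorems with citation tags; proofs where landed; nothing here is a claim about the Yang–Mills mass gap

CITATION HEADER (lean-in-tree rule).  Audit cell `pub-balaban`, sub-cell `t4`, BINDER row NE9; filed by NE9 crux-team LEAF PROVER 01 (`b2b-balaban-t4-ne9-formalise-leaf-01`,
gen 95; bears_on: R4/N22).  Source READ first-hand (`paper:balaban1985-cmp99-background-propagators`, pp. 394–398, 419, 426).  REUSED BY NAME: this lineage's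
`B9Eq344ResolventGradientRowTower.exists_gradRow_resolvent_covDiv_holder`, `B9Eq344HessianRowDecomposition.covDeriv_hessSlice_eq`, `B9Eq3117CommutatorBound.
norm_commutator_sum_le`, `adTransportW_inv_adTransportW'`; gen 93's `B9Eq342ResolventGradLetterTower.exists_gradLetter_resolvent`, `B9Eq342GreenPrimeSupBound.
norm_adTransportW_eq`, `B9Eq384RemainderLetters.norm_adTransportW_sub_le`, `B9Eq342GradientRowNaturalPerturbation.weight_site_shift_le`∕`_unshift_le`;
`B9SectCLatticeFrame.one_le_tdist_of_ne`.  Nothing printed is a hypothesis.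

WHAT IS PROVED (sorry-free; proof lane — 0 `def`).
* §0 `ccoord_shift_shift`, `tdist_shift_shift` (`d(y+e_μ, y′+e_μ) = d(y,y′)` on the torus).
* §1 **`exists_hessRow_of_laplace_eq`** (`1 ≤ d`, `L ≥ 3`): `∃ (αH, ΘH, κH)` such that on the model's block (binders as in (L2), plus the plaquette window
  `‖U(∂p_{κν}(x)) − 1‖ ≤ αη²` for all `κ, ν, x` in `B9Eq39Adjoint.plaqU` form and the current window `‖J_μ(y)‖ ≤ α`), for every rate `a` (`a·d·L^{n+1} ≤ κH`, `aL^{n+1} ≤ 1`,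
  window), centre `x₀`, and `u, ω, N_ω, H_ω, M_u, M_w` as above: `‖(D_U(D_Uu)(·,μ))(b)‖ ≤ ΘH·(N_ω + H_ω + M_u + M_w)·W_{x₀}(b₋)`, `ΘH = ΘG(3 + 6c) + Θg(30dM_φM_φ′ + 1)`.
HONEST SCOPE.  A letter on the MODEL; the (T4E) block's `_hpl` (`plaqHolU`, `μ < ν`) gives the `plaqU` form by `B9Eq3117Current.plaqU_swap` and `U1`.  Nothing of print's Thm 3.1 ∕ 3.13
on print's objects is asserted; «NE9 ⇐ the named binders»; NE9 NOT PRINTED ∕ NOT PROVED; row WALLED ON A MODEL (O-NE9-1; #5 UNRULED); spine PROVED 0∕9; rung (B)+1 on a finite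
T⁴ — NOT infinite volume, NOT mass gap, NOT BetaPertH, NOT Clay.  NEW file; nothing modified.  Net new unproved facts: 0.
-/

noncomputable section

open scoped InnerProductSpace BigOperators

namespace Literature.MathematicalPhysics.QuantumFieldTheory.Balaban1983to89.B9Eq344CovariantHessianRowTower

open B4Sect5Torus (TSite tdist tdist_nonneg ccoord ccoord_cast)
open B4TorusKernel.MultiPeriod (circAbs circAbs_add_mul)
open B9SectCLatticeCarrier (Bond bpos shift unshift shift_apply_val shift_apply_ne)
open B9Eq311L2Pairing (WL2)
open B7Prop1Explicit (U1 mem_U1 norm_inv_sub_one_le)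
open B9Eq310HessianOperator (adTransportW)
open B9Eq315QTower (towerP towerP_apply UlevOf)
open B9Eq324DeltaPrimeATower (laplacePrimeAk)
open B11Eq103H1Complex (SiteL2K BondL2K covDerivL2K covDivL2K covLaplaceSiteK greenK equiv_covDerivL2K)
open B9Eq33CovDerivVector (covDeriv shiftEquiv)
open B9Eq39Adjoint (plaqU J)
open B9Eq384RemainderLetters (norm_adTransportW_sub_le)
open B9Eq342GreenPrimeSupBound (norm_adTransportW_eq)
open B9Eq342GradientRowNaturalPerturbation (weight_site_shift_le weight_site_unshift_le)
open B9Eq342ResolventGradLetterTower (exists_gradLetter_resolvent)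
open B9Eq344ResolventGradientRowTower (exists_gradRow_resolvent_covDiv_holder)
open B9Eq344HessianRowDecomposition (covDeriv_hessSlice_eq)
open B9Eq3117CommutatorBound (norm_commutator_sum_le adTransportW_inv_adTransportW')
open B9SectCLatticeFrame (one_le_tdist_of_ne)

/-! ## §0 Translation invariance of the torus distance -/

section Torus

variable {d : ℕ} {Pd : Fin d → ℕ}

/-- `ccoord (y+e_μ) (y′+e_μ) = ccoord y y′` coordinatewise. [folklore] [cite: Balaban1985BackgroundPropagators, (3.42) p.397] -/
theorem ccoord_shift_shift (hP : ∀ i, 1 ≤ Pd i) (μ : Fin d) (y y' : TSite d Pd) (i : Fin d) :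
    ccoord Pd (shift μ y) (shift μ y') i = ccoord Pd y y' i := by
  have h1 := ccoord_cast hP (shift μ y) (shift μ y') i
  have h2 := ccoord_cast hP y y' i
  by_cases hi : i = μ
  · subst hi
    have e : ((((shift i y) i).val : ℤ) - (((shift i y') i).val : ℤ)) =
        (((y i).val : ℤ) - ((y' i).val : ℤ)) + (Pd i : ℤ) * ((((y' i).val : ℤ) + 1) / (Pd i : ℤ) - (((y i).val : ℤ) + 1) / (Pd i : ℤ)) := by
      rw [shift_apply_val, shift_apply_val]
      push_cast
      rw [Int.emod_def, Int.emod_def]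
      ring
    have : ((ccoord Pd (shift i y) (shift i y') i : ℕ) : ℤ) = ((ccoord Pd y y' i : ℕ) : ℤ) := by
      rw [h1, h2, e, circAbs_add_mul]
    exact_mod_cast this
  · have : ((ccoord Pd (shift μ y) (shift μ y') i : ℕ) : ℤ) = ((ccoord Pd y y' i : ℕ) : ℤ) := by
      rw [h1, h2, shift_apply_ne hi, shift_apply_ne hi]
    exact_mod_cast this

/-- **`d(y+e_μ, y′+e_μ) = d(y,y′)`**: the torus distance is translation invariant. [folklore] [cite: Balaban1985BackgroundPropagators, (3.42) p.397] -/
theorem tdist_shift_shift (hP : ∀ i, 1 ≤ Pd i) (μ : Fin d) (y y' : TSite d Pd) : tdist Pd (shift μ y) (shift μ y') = tdist Pd y y' := by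
  unfold tdist
  congr 2
  funext i
  exact ccoord_shift_shift hP μ y y' i

end Torus

/-! ## §1 The covariant Hessian row of a solution of `Δ^η_Uu = ω` -/

section Main

variable {d : ℕ} (L : ℕ) [NeZero L] (hL3 : 3 ≤ L)
  {𝔸 : Type*} [NormedRing 𝔸] [NormedAlgebra ℂ 𝔸] [CompleteSpace 𝔸] [NormOneClass 𝔸] [StarRing 𝔸]
  {W : Type*} [NormedAddCommGroup W] [InnerProductSpace ℂ W] [FiniteDimensional ℂ W] (φ : W ≃ₗ[ℂ] 𝔸)
  {a' Mφ Mφ' : ℝ} (hMφ : 0 ≤ Mφ) (hMφ' : 0 ≤ Mφ') (hφ : ∀ w, ‖φ w‖ ≤ Mφ * ‖w‖) (hφ' : ∀ X, ‖φ.symm X‖ ≤ Mφ' * ‖X‖) (ha' : 0 < a')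
  {r : ℝ} (hr0 : 0 ≤ r) (hr1 : r < 1)
  (τ : 𝔸 →ₗ[ℂ] ℂ) (hτ₂ : ∀ X Y : 𝔸, τ (X * Y) = τ (Y * X)) (hφτ : ∀ X Y : 𝔸, ⟪φ.symm X, φ.symm Y⟫_ℂ = τ (star X * Y))

/-- arithmetic of the constant (outside the big context). [folklore] -/
private theorem const_le {ΘG Θg c c' dd Nω Hω Mu Mw : ℝ} (hΘG : 0 ≤ ΘG) (hΘg : 0 ≤ Θg) (hc : 0 ≤ c) (hc' : 0 ≤ c') (hd : 1 ≤ dd)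
    (hN : 0 ≤ Nω) (hH : 0 ≤ Hω) (hMu : 0 ≤ Mu) (hMw : 0 ≤ Mw) :
    ΘG * (3 * Nω + (3 * Hω + 6 * c * Nω)) + Θg * (c' * (30 * dd * Mu + 24 * dd * Mw) + Mw) ≤
      (ΘG * (3 + 6 * c) + Θg * (30 * dd * c' + 1)) * (Nω + Hω + Mu + Mw) := by
  have hdd : 0 ≤ dd := le_trans zero_le_one hd
  have hS : 0 ≤ Nω + Hω + Mu + Mw := by positivity
  have h1 : ΘG * (3 * Nω + (3 * Hω + 6 * c * Nω)) ≤ ΘG * (3 + 6 * c) * (Nω + Hω + Mu + Mw) := by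
    have h : 3 * Nω + (3 * Hω + 6 * c * Nω) ≤ (3 + 6 * c) * (Nω + Hω + Mu + Mw) := by
      nlinarith [mul_nonneg hc hH, mul_nonneg hc hMu, mul_nonneg hc hMw]
    calc ΘG * (3 * Nω + (3 * Hω + 6 * c * Nω)) ≤ ΘG * ((3 + 6 * c) * (Nω + Hω + Mu + Mw)) := mul_le_mul_of_nonneg_left h hΘG
      _ = _ := by ring
  have h2 : Θg * (c' * (30 * dd * Mu + 24 * dd * Mw) + Mw) ≤ Θg * (30 * dd * c' + 1) * (Nω + Hω + Mu + Mw) := by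
    have hk : 0 ≤ dd * c' := mul_nonneg hdd hc'
    have h : c' * (30 * dd * Mu + 24 * dd * Mw) + Mw ≤ (30 * dd * c' + 1) * (Nω + Hω + Mu + Mw) := by
      nlinarith [mul_nonneg hk hMw, mul_nonneg hk hN, mul_nonneg hk hH, mul_nonneg hk hMu]
    calc Θg * (c' * (30 * dd * Mu + 24 * dd * Mw) + Mw) ≤ Θg * ((30 * dd * c' + 1) * (Nω + Hω + Mu + Mw)) := mul_le_mul_of_nonneg_left h hΘg
      _ = _ := by ring
  linarith

/-- the coefficient of `‖u‖` in the commutator bound under the windows `‖J‖ ≤ α ≤ 1`, `η ≤ 1`: `2‖J‖ + 8dα²η ≤ 10d`. [folklore] -/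
private theorem coef_le {nJ α η dd : ℝ} (hJ : nJ ≤ α) (hα0 : 0 ≤ α) (hα1 : α ≤ 1) (hη0 : 0 ≤ η) (hη1 : η ≤ 1) (hd1 : 1 ≤ dd) :
    2 * nJ + 8 * dd * α ^ 2 * η ≤ 10 * dd := by
  have h0 : 0 ≤ α ^ 2 * η := mul_nonneg (pow_nonneg hα0 2) hη0
  have h1 : α ^ 2 * η ≤ 1 := by
    calc α ^ 2 * η ≤ 1 ^ 2 * 1 := mul_le_mul (pow_le_pow_left₀ hα0 hα1 2) hη1 hη0 (by positivity)
      _ = 1 := by norm_num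
  have hdd : 0 ≤ dd := le_trans zero_le_one hd1
  nlinarith [mul_nonneg hdd h0, mul_le_mul_of_nonneg_left h1 hdd]

include hL3 hMφ hMφ' hφ hφ' ha' hr0 hr1 hτ₂ hφτ in
/-- **THE `cosh`-WEIGHTED COVARIANT HESSIAN ROW OF A SOLUTION OF `Δ^η_Uu = ω` ON THE MODEL, CLOSED.**  For `1 ≤ d`, `L ≥ 3`: `∃ αH ΘH κH` such that for every background of
the model with its level letters, the plaquette window `‖U(∂p_{κν}(x)) − 1‖ ≤ αη²` (all `κ, ν, x`), the current window `‖J_μ(y)‖ ≤ α` ((3.36)), any positivity witnesses, every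
rate `a` (`a·d·L^{n+1} ≤ κH`, `aL^{n+1} ≤ 1`, `2d(L^{n+1})²(cosh a − 1) ≤ ½`), every centre `x₀` and all `u, ω` with `Δ^η_Uu = ω` and `‖ω(y)‖ ≤ N_ω·W_{x₀}(y)`,
`‖ω(y′) − ω(y)‖ ≤ H_ω·W_{x₀}(y)·(d(y,y′)∕L^{n+1})^{½}` (`d(y,y′) ≤ L^{n+1}`), `‖u(y)‖ ≤ M_u·W_{x₀}(y)`, `‖(D_Uu)(b)‖ ≤ M_w·W_{x₀}(b₋)`:
`‖(D_U((D_Uu)(·,μ)))(b)‖ ≤ ΘH·(N_ω + H_ω + M_u + M_w)·W_{x₀}(b₋)` — the (3.44)∕Thm 3.13-shaped second-order row, η-scale, in the weighted sup currency.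
[cite: Balaban1985BackgroundPropagators, Thm 3.1 (3.44) p.398, (3.117)–(3.120) p.419, Thm 3.13 p.426, (3.35)–(3.36) p.396] -/
theorem exists_hessRow_of_laplace_eq (hd : 1 ≤ d) :
    ∃ αH ΘH κH : ℝ, 0 < αH ∧ 0 ≤ ΘH ∧ 0 < κH ∧
      ∀ (n : ℕ) (η : ℝ), η * (L : ℝ) ^ (n + 1) = 1 →
      ∀ (c₀ c₁ : ℝ) [Fact (0 < c₀)] [Fact (0 < c₁)], c₀ * ((L : ℝ) ^ (n + 1)) ^ d = c₁ →
      ∀ (m : Fin d → ℕ) [∀ i, NeZero (m i)] (U : Bond d (towerP L m (n + 1)) → 𝔸ˣ),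
      ∀ (α : ℝ), 0 ≤ α → α ≤ αH → (∀ b, U b ∈ U1 𝔸) → (∀ b, ‖(U b : 𝔸) - 1‖ ≤ α * η) →
        (∀ (x : TSite d (towerP L m (n + 1))) (μ : Fin d), ‖(U (x, μ) : 𝔸) - U (unshift μ x, μ)‖ ≤ α * η ^ 2) →
        (∀ (κ ν : Fin d) (x : TSite d (towerP L m (n + 1))),
          ‖((plaqU (fun μ => shiftEquiv (Pd := towerP L m (n + 1)) μ) (fun μ y => U (y, μ)) κ ν x : 𝔸ˣ) : 𝔸) - 1‖ ≤ α * η ^ 2) →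
        (∀ (μ : Fin d) (y : TSite d (towerP L m (n + 1))), ‖J (fun μ => shiftEquiv (Pd := towerP L m (n + 1)) μ) (fun μ y => U (y, μ)) η μ y‖ ≤ α) →
      ∀ (εU : ℕ → ℝ), (∀ j, 0 ≤ εU j) → (∀ j < n + 1, εU j ≤ α * r ^ j) →
        (∀ (j : ℕ) (b : Bond d (towerP L m (j + 1))), ‖(UlevOf L m (n + 1) U j b : 𝔸) - 1‖ ≤ εU j) →
        (∀ (j : ℕ) (b : Bond d (towerP L m (j + 1))), UlevOf L m (n + 1) U j b ∈ U1 𝔸) →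
        ∀ (hUst : ∀ b, star (U b : 𝔸) = ((U b)⁻¹ : 𝔸ˣ)),
        (∀ (j : ℕ) (b : Bond d (towerP L m (j + 1))) (w : W), ‖adTransportW φ (UlevOf L m (n + 1) U j) b w‖ ≤ ‖w‖) →
      ∀ (hpos' : ∀ x : SiteL2K ℂ d (towerP L m (n + 1)) c₀ W, x ≠ 0 → 0 < RCLike.re ⟪x, laplacePrimeAk L m n φ η U a' (c₁ := c₁) x⟫_ℂ)
        (hpos₁ : ∀ x : SiteL2K ℂ d (towerP L m (n + 1)) c₀ W, x ≠ 0 →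
          0 < RCLike.re ⟪x, ((covLaplaceSiteK (c₀ := c₀) ((η : ℂ))⁻¹ (adTransportW φ U) (adTransportW φ fun b => (U b)⁻¹) + (1 : ℂ) • LinearMap.id :
            SiteL2K ℂ d (towerP L m (n + 1)) c₀ W →ₗ[ℂ] SiteL2K ℂ d (towerP L m (n + 1)) c₀ W)) x⟫_ℂ)
        (a : ℝ), 0 ≤ a → a * d * (L : ℝ) ^ (n + 1) ≤ κH → a * (L : ℝ) ^ (n + 1) ≤ 1 → 2 * (d : ℝ) * ((L : ℝ) ^ (n + 1)) ^ 2 * (Real.cosh a - 1) ≤ 1 / 2 →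
      ∀ (x₀ : TSite d (towerP L m (n + 1))) (u ω : SiteL2K ℂ d (towerP L m (n + 1)) c₀ W) (Nω Hω Mu Mw : ℝ), 0 ≤ Nω → 0 ≤ Hω → 0 ≤ Mu → 0 ≤ Mw →
        covLaplaceSiteK (c₀ := c₀) ((η : ℂ))⁻¹ (adTransportW φ U) (adTransportW φ fun b => (U b)⁻¹) u = ω →
        (∀ y, ‖WL2.equiv ℂ (fun _ : TSite d (towerP L m (n + 1)) => c₀) W ω y‖ ≤ Nω * ∏ μ, Real.cosh (a * (circAbs (towerP L m (n + 1) μ)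
          ((((x₀ μ : ℕ) : ZMod (towerP L m (n + 1) μ)) - ((y μ : ℕ) : ZMod (towerP L m (n + 1) μ))).val) : ℝ))) →
        (∀ (y y' : TSite d (towerP L m (n + 1))), tdist (towerP L m (n + 1)) y y' ≤ (L : ℝ) ^ (n + 1) →
          ‖WL2.equiv ℂ (fun _ : TSite d (towerP L m (n + 1)) => c₀) W ω y' - WL2.equiv ℂ (fun _ : TSite d (towerP L m (n + 1)) => c₀) W ω y‖ ≤
            Hω * (∏ μ, Real.cosh (a * (circAbs (towerP L m (n + 1) μ) ((((x₀ μ : ℕ) : ZMod (towerP L m (n + 1) μ)) - ((y μ : ℕ) : ZMod (towerP L m (n + 1) μ))).val) : ℝ))) *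
              (tdist (towerP L m (n + 1)) y y' / (L : ℝ) ^ (n + 1)) ^ ((1 : ℝ) / 2)) →
        (∀ y, ‖WL2.equiv ℂ (fun _ : TSite d (towerP L m (n + 1)) => c₀) W u y‖ ≤ Mu * ∏ μ, Real.cosh (a * (circAbs (towerP L m (n + 1) μ)
          ((((x₀ μ : ℕ) : ZMod (towerP L m (n + 1) μ)) - ((y μ : ℕ) : ZMod (towerP L m (n + 1) μ))).val) : ℝ))) →
        (∀ b, ‖WL2.equiv ℂ (fun _ : Bond d (towerP L m (n + 1)) => c₀) W (covDerivL2K ℂ c₀ ((η : ℂ))⁻¹ (adTransportW φ U) u) b‖ ≤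
          Mw * ∏ μ, Real.cosh (a * (circAbs (towerP L m (n + 1) μ) ((((x₀ μ : ℕ) : ZMod (towerP L m (n + 1) μ)) - ((bpos b μ : ℕ) : ZMod (towerP L m (n + 1) μ))).val) : ℝ))) →
      ∀ (μ : Fin d) (b : Bond d (towerP L m (n + 1))),
        ‖WL2.equiv ℂ (fun _ : Bond d (towerP L m (n + 1)) => c₀) W (covDerivL2K ℂ c₀ ((η : ℂ))⁻¹ (adTransportW φ U)
            ((WL2.equiv ℂ (fun _ : TSite d (towerP L m (n + 1)) => c₀) W).symm fun y =>
              WL2.equiv ℂ (fun _ : Bond d (towerP L m (n + 1)) => c₀) W (covDerivL2K ℂ c₀ ((η : ℂ))⁻¹ (adTransportW φ U) u) (y, μ))) b‖ ≤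
          ΘH * (Nω + Hω + Mu + Mw) * ∏ ν, Real.cosh (a * (circAbs (towerP L m (n + 1) ν)
            ((((x₀ ν : ℕ) : ZMod (towerP L m (n + 1) ν)) - ((bpos b ν : ℕ) : ZMod (towerP L m (n + 1) ν))).val) : ℝ)) := by
  classical
  obtain ⟨αG, ΘG, κG, hαG, hΘG, hκG, HL2⟩ := exists_gradRow_resolvent_covDiv_holder L hL3 φ hMφ hMφ' hφ hφ' ha' hr0 hr1 τ hτ₂ hφτ hd
  obtain ⟨αg, Θg, κg, hαg, hΘg, hκg, HG⟩ := exists_gradLetter_resolvent L hL3 φ hMφ hMφ' hφ hφ' ha' hr0 hr1 τ hτ₂ hφτ hd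
  obtain ⟨c, hc⟩ : ∃ c : ℝ, c = 2 * Mφ * Mφ' := ⟨_, rfl⟩
  have hc0 : 0 ≤ c := by rw [hc]; positivity
  have hd1 : (1 : ℝ) ≤ d := by exact_mod_cast hd
  have hd0 : (0 : ℝ) ≤ d := Nat.cast_nonneg d
  refine ⟨min 1 (min αG αg), ΘG * (3 + 6 * c) + Θg * (30 * d * (Mφ * Mφ') + 1), min κG κg, lt_min one_pos (lt_min hαG hαg), by positivity,
    lt_min hκG hκg, ?_⟩
  intro n η hηL c₀ c₁ _ _ hw m _ U α hα hαle hUb hUη hUgrad hpl hJ εU hεU hεg hUε hLb hUst hRlev hpos' hpos₁ a ha0 haκ haK1 hlamK x₀ u ω Nω Hω Mu Mw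
    hN0 hH0 hMu0 hMw0 hEq hωN hωH huN hwN μ b
  have hα1 : α ≤ 1 := hαle.trans (min_le_left _ _)
  have hαG' : α ≤ αG := hαle.trans ((min_le_right _ _).trans (min_le_left _ _))
  have hαg' : α ≤ αg := hαle.trans ((min_le_right _ _).trans (min_le_right _ _))
  have haκG : a * d * (L : ℝ) ^ (n + 1) ≤ κG := haκ.trans (min_le_left _ _)
  have haκg : a * d * (L : ℝ) ^ (n + 1) ≤ κg := haκ.trans (min_le_right _ _)
  -- the scale letters
  have hK1 : (1 : ℝ) ≤ (L : ℝ) ^ (n + 1) := one_le_pow₀ (by exact_mod_cast (by omega : 1 ≤ L))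
  have hK0 : (0 : ℝ) < (L : ℝ) ^ (n + 1) := lt_of_lt_of_le one_pos hK1
  have hη0 : 0 < η := by nlinarith only [hηL, hK0]
  have hηK : η⁻¹ = (L : ℝ) ^ (n + 1) := inv_eq_of_mul_eq_one_right hηL
  have hηeq : η = ((L : ℝ) ^ (n + 1))⁻¹ := by rw [← hηK, inv_inv]
  have hη1 : η ≤ 1 := by rw [hηeq]; exact inv_le_one_of_one_le₀ hK1
  have hm1 : ∀ i, 1 ≤ m i := fun i => Nat.one_le_iff_ne_zero.mpr (NeZero.ne (m i))
  have hP1 : ∀ ν : Fin d, 1 ≤ towerP L m (n + 1) ν := fun ν => by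
    rw [towerP_apply]; exact Nat.one_le_iff_ne_zero.2 (Nat.mul_ne_zero (pow_ne_zero _ (by omega)) (by have := hm1 ν; omega))
  have hlamh : 2 * (d : ℝ) * η⁻¹ ^ 2 * (Real.cosh a - 1) ≤ 1 / 2 := by rw [hηK]; exact hlamK
  have ha1 : a ≤ 1 := by nlinarith only [haK1, hK1, ha0]
  have hea : Real.exp a ≤ 3 := (Real.exp_le_exp.2 ha1).trans (by have := Real.exp_one_lt_d9; linarith only [this])
  have hea0 : 0 ≤ Real.exp a := (Real.exp_pos a).le
  -- the weight
  set Wt : TSite d (towerP L m (n + 1)) → ℝ := fun y => ∏ ν, Real.cosh (a * (circAbs (towerP L m (n + 1) ν)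
    ((((x₀ ν : ℕ) : ZMod (towerP L m (n + 1) ν)) - ((y ν : ℕ) : ZMod (towerP L m (n + 1) ν))).val) : ℝ)) with hWt
  have hW0 : ∀ y, 0 ≤ Wt y := fun y => Finset.prod_nonneg fun _ _ => (Real.cosh_pos _).le
  have hWs : ∀ y κ, Wt (shift κ y) ≤ Real.exp a * Wt y := fun y κ => weight_site_shift_le ha0 x₀ y κ
  have hWu : ∀ y κ, Wt (unshift κ y) ≤ Real.exp a * Wt y := fun y κ => weight_site_unshift_le ha0 x₀ y κ
  -- the transporters
  have hSR : ∀ bb w, adTransportW φ (fun bb => (U bb)⁻¹) bb (adTransportW φ U bb w) = w := adTransportW_inv_adTransportW' φ U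
  have hUst' : ∀ bb, star (((U bb)⁻¹ : 𝔸ˣ) : 𝔸) = ((((U bb)⁻¹)⁻¹ : 𝔸ˣ) : 𝔸) := fun bb => by
    rw [inv_inv, ← hUst bb, star_star]
  have hRn : ∀ bb w, ‖adTransportW φ U bb w‖ ≤ ‖w‖ := fun bb w => (norm_adTransportW_eq φ U τ hτ₂ hUst hφτ bb w).le
  have hSn : ∀ bb w, ‖adTransportW φ (fun bb => (U bb)⁻¹) bb w‖ ≤ ‖w‖ := fun bb w =>
    (norm_adTransportW_eq φ (fun bb => (U bb)⁻¹) τ hτ₂ hUst' hφτ bb w).le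
  have hRε : ∀ bb w, ‖adTransportW φ U bb w - w‖ ≤ c * (α * η) * ‖w‖ := fun bb w => by
    have h := norm_adTransportW_sub_le φ hφ hφ' hMφ' U bb (hUb bb) (hUη bb) w; rw [hc]; linarith only [h]
  -- abbreviations
  set uf := WL2.equiv ℂ (fun _ : TSite d (towerP L m (n + 1)) => c₀) W u with huf
  set ωf := WL2.equiv ℂ (fun _ : TSite d (towerP L m (n + 1)) => c₀) W ω with hωf
  set Duf := WL2.equiv ℂ (fun _ : Bond d (towerP L m (n + 1)) => c₀) W (covDerivL2K ℂ c₀ ((η : ℂ))⁻¹ (adTransportW φ U) u) with hDuf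
  have hDuf' : covDeriv ((η : ℂ))⁻¹ (adTransportW φ U) uf = Duf := by rw [hDuf, equiv_covDerivL2K]
  -- THE DECOMPOSITION
  rw [covDeriv_hessSlice_eq ((η : ℂ))⁻¹ (adTransportW φ U) (adTransportW φ fun bb => (U bb)⁻¹) hSR hpos₁ u ω hEq μ, WL2.equiv_add, Pi.add_apply]
  refine (norm_add_le _ _).trans ?_
  -- THE FIRST WORD: (L2) on the data `A_ω`
  have hA : ∀ bb : Bond d (towerP L m (n + 1)), ‖WL2.equiv ℂ (fun _ : Bond d (towerP L m (n + 1)) => c₀) W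
      ((WL2.equiv ℂ (fun _ : Bond d (towerP L m (n + 1)) => c₀) W).symm fun bb : Bond d (towerP L m (n + 1)) =>
        if bb.2 = μ then -(adTransportW φ U (bb.1, μ) (ωf (shift μ bb.1))) else 0) bb‖ ≤ 3 * Nω * Wt (bpos bb) := by
    intro bb
    rw [Equiv.apply_symm_apply]
    have h0 : 0 ≤ 3 * Nω * Wt (bpos bb) := by positivity
    split_ifs with hκ
    · rw [norm_neg]
      calc _ ≤ ‖ωf (shift μ bb.1)‖ := hRn _ _
        _ ≤ Nω * Wt (shift μ bb.1) := hωN _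
        _ ≤ Nω * (Real.exp a * Wt bb.1) := mul_le_mul_of_nonneg_left (hWs _ _) hN0
        _ ≤ Nω * (3 * Wt bb.1) := by gcongr
        _ = 3 * Nω * Wt (bpos bb) := by ring
    · rw [norm_zero]; exact h0
  have hAH : ∀ (y y' : TSite d (towerP L m (n + 1))) (κ : Fin d), tdist (towerP L m (n + 1)) y y' ≤ (L : ℝ) ^ (n + 1) →
      ‖WL2.equiv ℂ (fun _ : Bond d (towerP L m (n + 1)) => c₀) W
          ((WL2.equiv ℂ (fun _ : Bond d (towerP L m (n + 1)) => c₀) W).symm fun bb : Bond d (towerP L m (n + 1)) =>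
            if bb.2 = μ then -(adTransportW φ U (bb.1, μ) (ωf (shift μ bb.1))) else 0) (y', κ) -
        WL2.equiv ℂ (fun _ : Bond d (towerP L m (n + 1)) => c₀) W
          ((WL2.equiv ℂ (fun _ : Bond d (towerP L m (n + 1)) => c₀) W).symm fun bb : Bond d (towerP L m (n + 1)) =>
            if bb.2 = μ then -(adTransportW φ U (bb.1, μ) (ωf (shift μ bb.1))) else 0) (y, κ)‖ ≤
        (3 * Hω + 6 * c * Nω) * Wt y * (tdist (towerP L m (n + 1)) y y' / (L : ℝ) ^ (n + 1)) ^ ((1 : ℝ) / 2) := by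
    intro y y' κ hyy
    rw [Equiv.apply_symm_apply]
    have ht0 : 0 ≤ tdist (towerP L m (n + 1)) y y' := tdist_nonneg _ _ _
    have hs0 : 0 ≤ (tdist (towerP L m (n + 1)) y y' / (L : ℝ) ^ (n + 1)) ^ ((1 : ℝ) / 2) := Real.rpow_nonneg (by positivity) _
    have h0 : 0 ≤ (3 * Hω + 6 * c * Nω) * Wt y * (tdist (towerP L m (n + 1)) y y' / (L : ℝ) ^ (n + 1)) ^ ((1 : ℝ) / 2) := by
      have := hW0 y; positivity
    split_ifs with hκ
    · by_cases hy : y = y'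
      · subst hy; rw [sub_self, norm_zero]; exact h0
      -- `η ≤ (d(y,y′)∕K)^{½}`
      have ht1 : 1 ≤ tdist (towerP L m (n + 1)) y y' := one_le_tdist_of_ne hP1 hy
      have hs1 : tdist (towerP L m (n + 1)) y y' / (L : ℝ) ^ (n + 1) ≤ 1 := by rw [div_le_one hK0]; exact hyy
      have hηs : η ≤ (tdist (towerP L m (n + 1)) y y' / (L : ℝ) ^ (n + 1)) ^ ((1 : ℝ) / 2) := by
        have h1 : η ≤ tdist (towerP L m (n + 1)) y y' / (L : ℝ) ^ (n + 1) := by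
          rw [hηeq, le_div_iff₀ hK0, inv_mul_cancel₀ hK0.ne']; exact ht1
        refine h1.trans ?_
        have h2 := Real.rpow_le_rpow_of_exponent_ge (lt_of_lt_of_le (by positivity : (0 : ℝ) < η) h1) hs1 (by norm_num : (1 : ℝ) / 2 ≤ 1)
        rwa [Real.rpow_one] at h2
      -- the three pieces
      set ω₀ := ωf (shift μ y) with hω₀
      set ω₁ := ωf (shift μ y') with hω₁
      have e : -(adTransportW φ U (y', μ) ω₁) - -(adTransportW φ U (y, μ) ω₀) =
          -(adTransportW φ U (y', μ) (ω₁ - ω₀)) - (adTransportW φ U (y', μ) ω₀ - ω₀) + (adTransportW φ U (y, μ) ω₀ - ω₀) := by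
        rw [map_sub]; abel
      rw [e]
      have hω₀n : ‖ω₀‖ ≤ Nω * (Real.exp a * Wt y) := (hωN _).trans (mul_le_mul_of_nonneg_left (hWs _ _) hN0)
      have p1 : ‖-(adTransportW φ U (y', μ) (ω₁ - ω₀))‖ ≤ Hω * (Real.exp a * Wt y) * (tdist (towerP L m (n + 1)) y y' / (L : ℝ) ^ (n + 1)) ^ ((1 : ℝ) / 2) := by
        rw [norm_neg]
        refine (hRn _ _).trans ?_
        have h := hωH (shift μ y) (shift μ y') (by rw [tdist_shift_shift hP1]; exact hyy)
        rw [tdist_shift_shift hP1] at h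
        refine h.trans ?_
        refine mul_le_mul_of_nonneg_right (mul_le_mul_of_nonneg_left (hWs y μ) hH0) hs0
      have p2 : ∀ z : TSite d (towerP L m (n + 1)), ‖adTransportW φ U (z, μ) ω₀ - ω₀‖ ≤
          c * Nω * (Real.exp a * Wt y) * (tdist (towerP L m (n + 1)) y y' / (L : ℝ) ^ (n + 1)) ^ ((1 : ℝ) / 2) := by
        intro z
        refine (hRε _ _).trans ?_
        calc c * (α * η) * ‖ω₀‖ ≤ c * (1 * (tdist (towerP L m (n + 1)) y y' / (L : ℝ) ^ (n + 1)) ^ ((1 : ℝ) / 2)) * (Nω * (Real.exp a * Wt y)) := by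
              apply mul_le_mul (mul_le_mul_of_nonneg_left (mul_le_mul hα1 hηs hη0.le zero_le_one) hc0) hω₀n (norm_nonneg _) (by positivity)
          _ = _ := by ring
      calc ‖-(adTransportW φ U (y', μ) (ω₁ - ω₀)) - (adTransportW φ U (y', μ) ω₀ - ω₀) + (adTransportW φ U (y, μ) ω₀ - ω₀)‖
          ≤ ‖-(adTransportW φ U (y', μ) (ω₁ - ω₀)) - (adTransportW φ U (y', μ) ω₀ - ω₀)‖ + ‖adTransportW φ U (y, μ) ω₀ - ω₀‖ := norm_add_le _ _
        _ ≤ (‖-(adTransportW φ U (y', μ) (ω₁ - ω₀))‖ + ‖adTransportW φ U (y', μ) ω₀ - ω₀‖) + ‖adTransportW φ U (y, μ) ω₀ - ω₀‖ := by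
          gcongr; exact norm_sub_le _ _
        _ ≤ (Hω * (Real.exp a * Wt y) * (tdist (towerP L m (n + 1)) y y' / (L : ℝ) ^ (n + 1)) ^ ((1 : ℝ) / 2) +
              c * Nω * (Real.exp a * Wt y) * (tdist (towerP L m (n + 1)) y y' / (L : ℝ) ^ (n + 1)) ^ ((1 : ℝ) / 2)) +
            c * Nω * (Real.exp a * Wt y) * (tdist (towerP L m (n + 1)) y y' / (L : ℝ) ^ (n + 1)) ^ ((1 : ℝ) / 2) :=
          add_le_add (add_le_add p1 (p2 y')) (p2 y)
        _ = (Hω + 2 * c * Nω) * Real.exp a * (Wt y * (tdist (towerP L m (n + 1)) y y' / (L : ℝ) ^ (n + 1)) ^ ((1 : ℝ) / 2)) := by ring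
        _ ≤ (Hω + 2 * c * Nω) * 3 * (Wt y * (tdist (towerP L m (n + 1)) y y' / (L : ℝ) ^ (n + 1)) ^ ((1 : ℝ) / 2)) := by
          have hW := hW0 y
          have : 0 ≤ Hω + 2 * c * Nω := by positivity
          exact mul_le_mul_of_nonneg_right (mul_le_mul_of_nonneg_left hea this) (by positivity)
        _ = _ := by ring
    · rw [sub_self, norm_zero]; exact h0
  have h1 := HL2 n η hηL c₀ c₁ hw m U α hα hαG' hUb hUη hUgrad εU hεU hεg hUε hLb hUst hRlev hpos' hpos₁ a ha0 haκG haK1 hlamK x₀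
    ((WL2.equiv ℂ (fun _ : Bond d (towerP L m (n + 1)) => c₀) W).symm fun bb : Bond d (towerP L m (n + 1)) =>
      if bb.2 = μ then -(adTransportW φ U (bb.1, μ) (ωf (shift μ bb.1))) else 0)
    (3 * Nω) (3 * Hω + 6 * c * Nω) (by positivity) (by positivity) hA hAH b
  -- THE SECOND WORD: (L1) on the sup data `Comm_μ(u) + w_μ`
  have hg : ∀ y : TSite d (towerP L m (n + 1)), ‖WL2.equiv ℂ (fun _ : TSite d (towerP L m (n + 1)) => c₀) W
      ((WL2.equiv ℂ (fun _ : TSite d (towerP L m (n + 1)) => c₀) W).symm fun x =>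
        ((η : ℂ))⁻¹ • (((η : ℂ))⁻¹ • (((η : ℂ))⁻¹ • ∑ κ,
          ((adTransportW φ U (x, μ) (adTransportW φ U (shift μ x, κ) (uf (shift κ (shift μ x)))) -
              adTransportW φ U (x, κ) (adTransportW φ U (shift κ x, μ) (uf (shift μ (shift κ x))))) +
           (adTransportW φ U (x, μ) (adTransportW φ (fun bb => (U bb)⁻¹) (unshift κ (shift μ x), κ) (uf (unshift κ (shift μ x)))) -
              adTransportW φ (fun bb => (U bb)⁻¹) (unshift κ x, κ) (adTransportW φ U (unshift κ x, μ) (uf (shift μ (unshift κ x)))))))) +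
          Duf (x, μ)) y‖ ≤ (Mφ * Mφ' * (30 * d * Mu + 24 * d * Mw) + Mw) * Wt y := by
    intro y
    rw [Equiv.apply_symm_apply]
    have hC := norm_commutator_sum_le φ hφ hφ' hMφ hMφ' U hUb hη0 hα hpl hRn hSn uf μ y
    rw [hDuf'] at hC
    have hJy := hJ μ y
    -- the data near `y + e_μ`
    have hu1 : ‖uf (shift μ y)‖ ≤ Mu * (Real.exp a * Wt y) := (huN _).trans (mul_le_mul_of_nonneg_left (hWs _ _) hMu0)
    have hw1 : ∀ κ, ‖Duf (shift μ y, κ)‖ ≤ Mw * (Real.exp a * Wt y) := fun κ => (hwN _).trans (mul_le_mul_of_nonneg_left (hWs _ _) hMw0)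
    have hw2 : ∀ κ, ‖Duf (unshift κ (shift μ y), κ)‖ ≤ Mw * (Real.exp a * (Real.exp a * Wt y)) := fun κ =>
      (hwN _).trans (mul_le_mul_of_nonneg_left ((hWu _ _).trans (mul_le_mul_of_nonneg_left (hWs _ _) hea0)) hMw0)
    have hsum : ∑ κ : Fin d, (‖Duf (shift μ y, κ)‖ + ‖Duf (unshift κ (shift μ y), κ)‖) ≤ d * (12 * Mw * Wt y) := by
      calc _ ≤ ∑ _κ : Fin d, 12 * Mw * Wt y := Finset.sum_le_sum fun κ _ => by
              have hW := hW0 y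
              calc ‖Duf (shift μ y, κ)‖ + ‖Duf (unshift κ (shift μ y), κ)‖ ≤ Mw * (Real.exp a * Wt y) + Mw * (Real.exp a * (Real.exp a * Wt y)) :=
                    add_le_add (hw1 κ) (hw2 κ)
                _ ≤ Mw * (3 * Wt y) + Mw * (3 * (3 * Wt y)) := by gcongr
                _ = 12 * Mw * Wt y := by ring
        _ = d * (12 * Mw * Wt y) := by rw [Finset.sum_const, Finset.card_univ, Fintype.card_fin, nsmul_eq_mul]
    have hcoef : (2 * ‖J (fun μ => shiftEquiv (Pd := towerP L m (n + 1)) μ) (fun μ y => U (y, μ)) η μ y‖ + 8 * d * α ^ 2 * η) * ‖uf (shift μ y)‖ ≤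
        30 * d * Mu * Wt y := by
      have hJ' : 2 * ‖J (fun μ => shiftEquiv (Pd := towerP L m (n + 1)) μ) (fun μ y => U (y, μ)) η μ y‖ + 8 * d * α ^ 2 * η ≤ 10 * d :=
        coef_le hJy hα hα1 hη0.le hη1 hd1
      have hW := hW0 y
      calc _ ≤ 10 * d * (Mu * (Real.exp a * Wt y)) := mul_le_mul hJ' hu1 (norm_nonneg _) (by positivity)
        _ ≤ 10 * d * (Mu * (3 * Wt y)) := by gcongr
        _ = 30 * d * Mu * Wt y := by ring
    calc _ ≤ ‖((η : ℂ))⁻¹ • (((η : ℂ))⁻¹ • (((η : ℂ))⁻¹ • ∑ κ,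
          ((adTransportW φ U (y, μ) (adTransportW φ U (shift μ y, κ) (uf (shift κ (shift μ y)))) -
              adTransportW φ U (y, κ) (adTransportW φ U (shift κ y, μ) (uf (shift μ (shift κ y))))) +
           (adTransportW φ U (y, μ) (adTransportW φ (fun bb => (U bb)⁻¹) (unshift κ (shift μ y), κ) (uf (unshift κ (shift μ y)))) -
              adTransportW φ (fun bb => (U bb)⁻¹) (unshift κ y, κ) (adTransportW φ U (unshift κ y, μ) (uf (shift μ (unshift κ y))))))))‖ +
          ‖Duf (y, μ)‖ := norm_add_le _ _
      _ ≤ Mφ * Mφ' * (30 * d * Mu * Wt y + 2 * α * (d * (12 * Mw * Wt y))) + Mw * Wt y := by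
          have hα2 : 0 ≤ 2 * α := by positivity
          have hMM : 0 ≤ Mφ * Mφ' := mul_nonneg hMφ hMφ'
          exact add_le_add (hC.trans (mul_le_mul_of_nonneg_left (add_le_add hcoef (mul_le_mul_of_nonneg_left hsum hα2)) hMM)) (hwN (y, μ))
      _ ≤ Mφ * Mφ' * (30 * d * Mu * Wt y + 2 * 1 * (d * (12 * Mw * Wt y))) + Mw * Wt y := by
          have hW := hW0 y
          have hMM : 0 ≤ Mφ * Mφ' := mul_nonneg hMφ hMφ'
          have hX : 0 ≤ d * (12 * Mw * Wt y) := by positivity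
          have : 2 * α * (d * (12 * Mw * Wt y)) ≤ 2 * 1 * (d * (12 * Mw * Wt y)) :=
            mul_le_mul_of_nonneg_right (mul_le_mul_of_nonneg_left hα1 (by norm_num)) hX
          exact add_le_add (mul_le_mul_of_nonneg_left (add_le_add le_rfl this) hMM) le_rfl
      _ = _ := by ring
  have h2 := HG n η hηL c₀ c₁ hw m U α hα hαg' hUb hUη hUgrad εU hεU hεg hUε hLb hUst hRlev hpos' hpos₁ a ha0 haκg hlamh x₀ _
    (Mφ * Mφ' * (30 * d * Mu + 24 * d * Mw) + Mw) (by positivity) hg b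
  -- assembly
  refine (add_le_add h1 h2).trans ?_
  rw [← add_mul]
  exact mul_le_mul_of_nonneg_right (const_le hΘG hΘg hc0 (mul_nonneg hMφ hMφ') hd1 hN0 hH0 hMu0 hMw0) (hW0 _)

end Main

end Literature.MathematicalPhysics.QuantumFieldTheory.Balaban1983to89.B9Eq344CovariantHessianRowTower

end
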